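import Summits.Ventures.Crystal3D.StickySpheres.RadiusOne
import HarnessLib

/-!
# Lower-bound witnesses for small contact numbers: `C(9) ≥ 21`, `C(10) ≥ 25`, `C(11) ≥ 29`,
# `C(12) ≥ 33`

HONEST FRAMING. Part of the venture `Summits/Ventures/Crystal3D` (cell `pub-crystal3d`). This file
PROVES lower bounds only, by explicit integer models checked in the kernel; the matching upper
bounds (`C(9) ≤ 21`, …) are enumeration results in print ("the status of the mathematical rigour …
remains to be seen", Bezdek 2013) and are NOT claimed here. Together with the tree's imported
facts `maxContacts_three_six : C(6) = 12` and `fccNucleus_le_maxContacts : C(13 + k) ≥ 36 + 4k`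
(`StickySpheres/RadiusOne.lean`) this covers the construction side of the small table.

## The models (Bezdek 2013, §2.1, verbatim construction)

"take the union `U` of two regular octahedra of edge length 2 in `𝔼³` such that they share a
regular triangle face `T` in common and lie on opposite sides of it. If we take the unit balls
centered at the nine vertices of `U`, then there are exactly 21 touching pairs among them. …
along each side of `T` two triangular faces of `U` meet such that for their four vertices there
exists precisely one point in `𝔼³` lying outside `U` and at distance 2 from each of the four
vertices" — adding these points one at a time gives `25, 29, 33` contacts for `10, 11, 12` balls.

Integer model (contact at squared distance `18`, i.e. scale `1/√18` for diameter-`1` balls): the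
octahedron `(±3,0,0), (0,±3,0), (0,0,±3)`; its reflection in the face `x + y + z = 3` adds
`(1,4,4), (4,1,4), (4,4,1)`; the three cap points are `(3,3,-3), (-3,3,3), (3,-3,3)` (each at
squared distance `18` from exactly four of the previous points and `≥ 54` from the others).
Separation (`≥ 18` between distinct labels) and the contact counts `21 + 4k` are checked by
`decide` in the kernel; `le_maxContacts_of_intConfig` turns them into bounds on `C(9 + k)`.
-/

namespace Summit.Ventures.Crystal3D

open Literature.Geometry.DiscreteGeometry (sqNormInt)
open Literature.Barriers.AtomisticToContinuum (intContactNumber)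

/-- Integer model (contact at squared distance `18`): two regular octahedra sharing the face
`{(3,0,0), (0,3,0), (0,0,3)}` (labels `0–8`), followed by the three tetrahedral cap points
(labels `9–11`). -/
def twinOcta12Int : Fin 12 → Fin 3 → ℤ :=
  ![![3, 0, 0], ![0, 3, 0], ![0, 0, 3], ![-3, 0, 0], ![0, -3, 0], ![0, 0, -3],
    ![1, 4, 4], ![4, 1, 4], ![4, 4, 1],
    ![3, 3, -3], ![-3, 3, 3], ![3, -3, 3]]

/-- The first `9 + k` labels of `twinOcta12Int` (`k ≤ 3`): the twin octahedra with `k` caps. -/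
def twinOctaInt (k : Fin 4) : Fin (9 + k) → Fin 3 → ℤ :=
  fun i => twinOcta12Int (i.castLE (by omega))

/-- Distinct labels are at squared distance `≥ 18` (no overlap at contact scale `18`). -/
theorem sep_twinOcta : ∀ k : Fin 4, ∀ i j : Fin (9 + k), i ≠ j →
    (18 : ℤ) ≤ sqNormInt (twinOctaInt k i - twinOctaInt k j) := by
  decide +kernel

/-- Contact counts `21 + 4k`: `12 + 12 - 3 = 21` for the twin octahedra, `4` more per cap. -/
theorem intContactNumber_twinOcta :
    ∀ k : Fin 4, intContactNumber (twinOctaInt k) 18 = 21 + 4 * (k : ℕ) := by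
  decide +kernel

/-- **`21 + 4k ≤ C(9 + k)`** for `k ≤ 3`: `C(9) ≥ 21`, `C(10) ≥ 25`, `C(11) ≥ 29`, `C(12) ≥ 33`
(Bezdek 2013 §2.1 constructions, kernel-checked). -/
theorem twinOcta_le_maxContacts (k : Fin 4) : 21 + 4 * (k : ℕ) ≤ maxContacts 3 (9 + k) :=
  le_maxContacts_of_intConfig (twinOctaInt k) (by norm_num) (sep_twinOcta k)
    (intContactNumber_twinOcta k)

/-- `C(9) ≥ 21`. -/
theorem twentyOne_le_maxContacts_nine : 21 ≤ maxContacts 3 9 := twinOcta_le_maxContacts 0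

/-- `C(10) ≥ 25`. -/
theorem twentyFive_le_maxContacts_ten : 25 ≤ maxContacts 3 10 := twinOcta_le_maxContacts 1

/-- `C(11) ≥ 29`. -/
theorem twentyNine_le_maxContacts_eleven : 29 ≤ maxContacts 3 11 := twinOcta_le_maxContacts 2

/-- `C(12) ≥ 33`. -/
theorem thirtyThree_le_maxContacts_twelve : 33 ≤ maxContacts 3 12 := twinOcta_le_maxContacts 3

end Summit.Ventures.Crystal3D
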